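import Summits.Ventures.PercRepro.S1TailJ3
import Summits.Ventures.PercRepro.S1LevelFourE

/-!
# PercRepro — S1 LEVEL FOUR, PHASE 6: C-025 at level `4` for every finite matroid and every `p ≥ 17` (p2, gen 15;
SUBCLAIM-S1 with LEMMAS J, J′ and K)

The Lemma-K cell inequality (`S1CellTableJ3.cellOK5`: the five-subsets counted once, on top of Lemmas J and J′)
closes every core cell `(p, d)` with `17 ≤ p ≤ 18`: `5 ≤ d ≤ 15` by `table_17_18`, `16 ≤ d ≤ 400` by
`table_17_18_16_400`, `d ≥ 401` by `cellOK5_of_tail`. With the cores of rank `≥ 19`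
(`S1LevelFourE.c025_core_four_all_corank19`) the `e`-free core is closed at EVERY `p ≥ 17` and every corank, so
`ThmN.rls_succ_large 3 4 17` gives level `4` at every `p ≥ 18` and `S1FixedFrame.rls_succ_fixed 3 4 17` gives `p = 17`.

* `c025_core_four_cellK` — the core cells `17 ≤ p ≤ 18`, every `d ≥ 5`;
* `c025_core_four_all_corank17` — the core at every `p ≥ 17`, every corank `≥ 5`;
* `c025_four_eighteen` — `ThmN.RLS M p 4` for `p ≥ 18`; `c025_four_seventeen_fixed` — at `p = 17`;
* **`c025_four_seventeen`** — THE END THEOREM: `ThmN.RLS M p 4` for every finite matroid and every `p ≥ 17`;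
  `c025_four_seventeen'` — the literal `C025` body.
Axioms: standard.
-/

open scoped Matroid

namespace PercRepro

namespace S1

variable {α : Type}

/-- **The Lemma-K core cells `17 ≤ p ≤ 18`, every corank `d ≥ 5`.** -/
theorem c025_core_four_cellK (M : Matroid α) [M.Finite] (p d : ℕ) (hp : 17 ≤ p) (hp' : p ≤ 18)
    (hd : 5 ≤ d) (hR : M.eRank = (p : ℕ∞)) (hn : M.E.ncard = p + d)
    (hfree : ∀ e ∈ M.E, ∃ A ⊆ M.E \ {e}, e ∉ M.closure A ∧ e ∉ M.closure ((M.E \ {e}) \ A)) :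
    ThmN.RLS M p 4 := by
  rcases Nat.lt_or_ge d 16 with h16 | h16
  · exact rls_of_cellOK5 M p d hR hn hfree (by omega) (table_17_18 p hp hp' d hd (by omega))
  rcases Nat.lt_or_ge d 401 with h401 | h401
  · exact rls_of_cellOK5 M p d hR hn hfree (by omega) (table_17_18_16_400 p (by omega) hp d h401 h16)
  · exact rls_of_cellOK5 M p d hR hn hfree (by omega) (cellOK5_of_tail p d hp hp' h401)

/-- **The `e`-free core at rank `p ≥ 17` and every corank `≥ 5`.** -/
theorem c025_core_four_all_corank17 (M : Matroid α) [M.Finite] (p : ℕ) (hp : 17 ≤ p)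
    (hR : M.eRank = (p : ℕ∞)) (hbig : p + 4 < M.E.ncard)
    (hfree : ∀ e ∈ M.E, ∃ A ⊆ M.E \ {e}, e ∉ M.closure A ∧ e ∉ M.closure ((M.E \ {e}) \ A)) :
    ThmN.RLS M p 4 := by
  rcases Nat.lt_or_ge p 19 with h18 | h19
  · exact c025_core_four_cellK M p (M.E.ncard - p) hp (by omega) (by omega) hR (by omega) hfree
  · exact c025_core_four_all_corank19 M p h19 hR hbig hfree

/-- **Level `4` for every `p ≥ 18`** (night-1's wrapper at threshold `17`). -/
theorem c025_four_eighteen (M : Matroid α) [M.Finite] (p : ℕ) (hp : 18 ≤ p) : ThmN.RLS M p 4 := by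
  refine ThmN.rls_succ_large (α := α) 3 4 17 ?_ ?_ ?_ M p hp (by omega)
  · intro M' _ p' _ hp'
    exact SevenThree.c025_three_all M' p' (by omega)
  · intro M' _ p' _ hn _
    rcases Nat.lt_or_ge M'.E.ncard (p' + 4) with h | h
    · exact ThmN.RLS_of_ncard_lt M' h
    · exact ThmN.RLS_of_ncard_eq M' (by omega)
  · intro M' _ p' hP hR hbig _ hfree
    exact c025_core_four_all_corank17 M' p' hP hR hbig hfree

/-- **Level `4` at rank `17`** (the fixed-rank frame). -/
theorem c025_four_seventeen_fixed (M : Matroid α) [M.Finite] : ThmN.RLS M 17 4 := by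
  refine rls_succ_fixed (α := α) 3 4 17 (by omega) ?_ ?_ ?_ M
  · intro M' _
    exact SevenThree.c025_three_all M' 16 (by omega)
  · intro M' _ hn
    rcases Nat.lt_or_ge M'.E.ncard (17 + 4) with h | h
    · exact ThmN.RLS_of_ncard_lt M' h
    · exact ThmN.RLS_of_ncard_eq M' (by omega)
  · intro M' _ hR hbig hfree
    exact c025_core_four_all_corank17 M' 17 (le_refl _) hR hbig hfree

/-- **THE END THEOREM OF PHASE 6**: every finite matroid satisfies C-025 at level `4` for every `p ≥ 17`:
`Φ(p, 4)·#{A ⊆ E : r(A) = p, r(E ∖ A) = 4} ≤ #{A ⊆ E : 4 < r(A) < p}`. -/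
theorem c025_four_seventeen (M : Matroid α) [M.Finite] (p : ℕ) (hp : 17 ≤ p) : ThmN.RLS M p 4 := by
  rcases Nat.lt_or_ge p 18 with h | h
  · have hp17 : p = 17 := by omega
    subst hp17
    exact c025_four_seventeen_fixed M
  · exact c025_four_eighteen M p h

/-- The phase-6 theorem in the literal vocabulary of `C025` (the body at `(p, 4)`). -/
theorem c025_four_seventeen' (M : Matroid α) [M.Finite] (p : ℕ) (hp : 17 ≤ p) :
    phiK p 4 * ({A : Set α | A ⊆ M.E ∧ M.eRk A = (p : ℕ∞) ∧ M.eRk (M.E \ A) = (4 : ℕ∞)}.ncard : ℚ) ≤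
      ({A : Set α | A ⊆ M.E ∧ (4 : ℕ∞) < M.eRk A ∧ M.eRk A < (p : ℕ∞)}.ncard : ℚ) :=
  c025_four_seventeen M p hp

end S1

end PercRepro
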